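import Mathlib
import HarnessLib

/-!
# The spin-chain (six-vertex / XXZ) representation of the Temperley–Lieb generators at loop weight 1

Topic `Literature/Probability/LatticeModels`. The Temperley–Lieb algebra `TL_L(δ)` with
`δ = -(q + q⁻¹)` acts on the spin chain `(ℂ²)^{⊗L}` (Pasquier–Saleur; Hagendorf–Liénardy,
J. Stat. Mech. (2021) 013104 = arXiv:2008.03220, §3.2 and §4, where the `Ř`-matrix of the six-vertex
model at `Δ = -1/2` is `Ř(x) = ([q/x] - [x] U)/[q x]` in the gauge used below): the generator at the
sites `a, b` acts on the two spins there by the `4 × 4` matrix which is zero on `|↑↑⟩, |↓↓⟩` and, on the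
basis `(|↑↓⟩, |↓↑⟩)`, the block `[[-q⁻¹, 1], [1, -q]]`; it is a rank-one idempotent times `δ`.

Here vectors are functions `f : SpinConfig L → K` on spin configurations `σ : Fin L → Bool`
(`true` = spin down) and **`spinTL q a b f`** is the action of the generator (matrix times column
vector). At a primitive cube root of unity (`q² + q + 1 = 0`, loop weight `δ = 1`, the percolation /
`Δ = -1/2` point) we prove the Temperley–Lieb relations: **`spinTL_spinTL`** (`U² = U`),
**`spinTL_cubic_left` / `spinTL_cubic_right`** (`U_{ab} U_{bc} U_{ab} = U_{ab}`,
`U_{bc} U_{ab} U_{bc} = U_{bc}` for distinct sites) and **`spinTL_comm`** (disjoint generators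
commute), plus linearity and the support property `spinTL_apply_of_eq` /
weight preservation `spinTL_eq_zero_of_downCount`. This is the vertex-model side of the loop/vertex
dictionary used for the inhomogeneous transfer matrix of critical percolation
(`Literature.Probability.Percolation.IkhlefPonsaingFirstPassage`).

## References

* C. Hagendorf, J. Liénardy, *The open XXZ chain at Δ = -1/2 and the boundary quantum
  Knizhnik–Zamolodchikov equations*, J. Stat. Mech. (2021) 013104, arXiv:2008.03220, §3.2.
  [HagendorfLienardy2021]
* V. Pasquier, H. Saleur, *Common structures between finite systems and conformal field theories
  through quantum groups*, Nucl. Phys. B 330 (1990) 523–556 (the `U_q(sl₂)`-invariant XXZ chain and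
  its Temperley–Lieb structure). [folklore]
-/

noncomputable section

namespace Literature.Probability.LatticeModels

namespace TemperleyLieb

variable {K : Type*} [Field K] {L : ℕ}

/-- A spin configuration of the chain with `L` sites: `σ i = true` means spin down at site `i`.
[folklore] -/
abbrev SpinConfig (L : ℕ) : Type := Fin L → Bool

/-- The configuration with the spins at `a` and `b` exchanged (as values). [folklore] -/
def spinFlip (a b : Fin L) (σ : SpinConfig L) : SpinConfig L :=
  Function.update (Function.update σ a (σ b)) b (σ a)

/-- **The Temperley–Lieb generator of the spin chain at the sites `a, b`** (`a` the left site),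
acting on vectors `f : SpinConfig L → K`: zero unless exactly one of the two spins is down, and then
`(U f)(σ) = (-q if σ a = ↓, -q⁻¹ if σ a = ↑) · f σ + f (σ with the two spins exchanged)` — the
block `[[-q⁻¹, 1], [1, -q]]` on `(|↑↓⟩, |↓↑⟩)`. [cite: HagendorfLienardy2021, §3.2] -/
def spinTL (q : K) (a b : Fin L) (f : SpinConfig L → K) : SpinConfig L → K :=
  fun σ => if σ a = σ b then 0 else (if σ a then -q else -q⁻¹) * f σ + f (spinFlip a b σ)

/-! ### Elementary properties -/

section Basic

variable (q : K) (a b : Fin L)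

/-- The generator vanishes on configurations with equal spins at the two sites. [folklore] -/
theorem spinTL_apply_of_eq {f : SpinConfig L → K} {σ : SpinConfig L} (h : σ a = σ b) :
    spinTL q a b f σ = 0 := by
  simp [spinTL, h]

/-- The generator on configurations with different spins at the two sites. [folklore] -/
theorem spinTL_apply_of_ne {f : SpinConfig L → K} {σ : SpinConfig L} (h : σ a ≠ σ b) :
    spinTL q a b f σ = (if σ a then -q else -q⁻¹) * f σ + f (spinFlip a b σ) := by
  simp [spinTL, h]

/-- The generator is additive. [folklore] -/
theorem spinTL_add (f g : SpinConfig L → K) :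
    spinTL q a b (f + g) = spinTL q a b f + spinTL q a b g := by
  funext σ
  by_cases h : σ a = σ b
  · simp [spinTL, h]
  · simp only [spinTL, h, if_false, Pi.add_apply]; ring

/-- The generator is homogeneous. [folklore] -/
theorem spinTL_smul (c : K) (f : SpinConfig L → K) :
    spinTL q a b (c • f) = c • spinTL q a b f := by
  funext σ
  by_cases h : σ a = σ b
  · simp [spinTL, h]
  · simp only [spinTL, h, if_false, Pi.smul_apply, smul_eq_mul]; ring

/-- The generator applied to the zero vector. [folklore] -/
theorem spinTL_zero : spinTL q a b (0 : SpinConfig L → K) = 0 := by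
  funext σ; by_cases h : σ a = σ b <;> simp [spinTL, h]

/-- The generator as a linear endomorphism. [folklore] -/
def spinTLMap : Module.End K (SpinConfig L → K) where
  toFun := spinTL q a b
  map_add' := spinTL_add q a b
  map_smul' := spinTL_smul q a b

/-- Unfolding the linear map. [folklore] -/
theorem spinTLMap_apply (f : SpinConfig L → K) : spinTLMap q a b f = spinTL q a b f := rfl

/-- Finite sums pass through the generator. [folklore] -/
theorem spinTL_sum {ι : Type*} (s : Finset ι) (f : ι → SpinConfig L → K) :
    spinTL q a b (∑ i ∈ s, f i) = ∑ i ∈ s, spinTL q a b (f i) :=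
  map_sum (spinTLMap q a b) f s

end Basic

/-! ### The spin flip -/

section Flip

variable {a b : Fin L}

/-- Value of the flipped configuration at the left site. [folklore] -/
theorem spinFlip_apply_left (hab : a ≠ b) (σ : SpinConfig L) : spinFlip a b σ a = σ b := by
  simp [spinFlip, Function.update_of_ne hab]

/-- Value of the flipped configuration at the right site. [folklore] -/
theorem spinFlip_apply_right (σ : SpinConfig L) : spinFlip a b σ b = σ a := by
  simp [spinFlip]

/-- The flip does not touch the other sites. [folklore] -/
theorem spinFlip_apply_of_ne {c : Fin L} (hca : c ≠ a) (hcb : c ≠ b) (σ : SpinConfig L) :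
    spinFlip a b σ c = σ c := by
  simp [spinFlip, Function.update_of_ne hcb, Function.update_of_ne hca]

/-- Flipping twice is the identity. [folklore] -/
theorem spinFlip_spinFlip (hab : a ≠ b) (σ : SpinConfig L) : spinFlip a b (spinFlip a b σ) = σ := by
  funext c
  by_cases hca : c = a
  · subst hca; rw [spinFlip_apply_left hab, spinFlip_apply_right]
  · by_cases hcb : c = b
    · subst hcb; rw [spinFlip_apply_right, spinFlip_apply_left hab]
    · rw [spinFlip_apply_of_ne hca hcb, spinFlip_apply_of_ne hca hcb]

/-- Flipping equal spins changes nothing. [folklore] -/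
theorem spinFlip_of_eq {σ : SpinConfig L} (h : σ a = σ b) : spinFlip a b σ = σ := by
  funext c
  by_cases hcb : c = b
  · subst hcb; rw [spinFlip_apply_right, h]
  · by_cases hca : c = a
    · subst hca; simp [spinFlip, Function.update_of_ne hcb, h]
    · rw [spinFlip_apply_of_ne hca hcb]

/-- The number of down spins is invariant under a flip. [folklore] -/
theorem count_spinFlip (hab : a ≠ b) (σ : SpinConfig L) :
    (Finset.univ.filter fun i => spinFlip a b σ i = true).card =
      (Finset.univ.filter fun i => σ i = true).card := by
  refine Finset.card_bij (fun i _ => Equiv.swap a b i) (fun i hi => ?_) (fun i _ j _ h => ?_) (fun j hj => ?_)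
  · simp only [Finset.mem_filter, Finset.mem_univ, true_and] at hi ⊢
    by_cases hia : i = a
    · subst hia; rwa [Equiv.swap_apply_left, ← spinFlip_apply_left hab σ]
    · by_cases hib : i = b
      · subst hib; rwa [Equiv.swap_apply_right, ← spinFlip_apply_right (a := a) σ]
      · rwa [Equiv.swap_apply_of_ne_of_ne hia hib, ← spinFlip_apply_of_ne hia hib σ]
  · exact (Equiv.swap a b).injective h
  · refine ⟨Equiv.swap a b j, ?_, by simp⟩
    simp only [Finset.mem_filter, Finset.mem_univ, true_and] at hj ⊢
    by_cases hja : j = a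
    · subst hja; rwa [Equiv.swap_apply_left, spinFlip_apply_right]
    · by_cases hjb : j = b
      · subst hjb; rwa [Equiv.swap_apply_right, spinFlip_apply_left hab]
      · rwa [Equiv.swap_apply_of_ne_of_ne hja hjb, spinFlip_apply_of_ne hja hjb]

end Flip

/-! ### Weight (number of down spins) is preserved -/

section Weight

variable (q : K) {a b : Fin L}

/-- The number of down spins of a configuration. [folklore] -/
def downCount (σ : SpinConfig L) : ℕ := (Finset.univ.filter fun i => σ i = true).card

/-- A flip preserves the number of down spins. [folklore] -/
theorem downCount_spinFlip (hab : a ≠ b) (σ : SpinConfig L) : downCount (spinFlip a b σ) = downCount σ :=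
  count_spinFlip hab σ

/-- **Weight preservation**: if `f` vanishes outside the configurations with `n` down spins, so
does `U f`. [folklore] -/
theorem spinTL_eq_zero_of_downCount (hab : a ≠ b) {n : ℕ} {f : SpinConfig L → K}
    (hf : ∀ σ, downCount σ ≠ n → f σ = 0) (σ : SpinConfig L) (hσ : downCount σ ≠ n) :
    spinTL q a b f σ = 0 := by
  by_cases h : σ a = σ b
  · exact spinTL_apply_of_eq q a b h
  · rw [spinTL_apply_of_ne q a b h, hf σ hσ, hf _ (by rwa [downCount_spinFlip hab]), mul_zero, add_zero]

end Weight

/-! ### The Temperley–Lieb relations at loop weight one -/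

section Relations

variable {q : K} (hq : q ^ 2 + q + 1 = 0)
include hq

/-- `q⁻¹ = -q - 1` at a primitive cube root of unity. [folklore] -/
theorem inv_eq_of_quad : q⁻¹ = -q - 1 := by
  have hq0 : q ≠ 0 := by rintro rfl; norm_num at hq
  field_simp
  linear_combination hq

variable {a b c : Fin L}

/-- **`U² = U`** (loop weight `δ = -(q + q⁻¹) = 1`). [cite: HagendorfLienardy2021, §3.2] -/
theorem spinTL_spinTL (hab : a ≠ b) (f : SpinConfig L → K) :
    spinTL q a b (spinTL q a b f) = spinTL q a b f := by
  have hinv := inv_eq_of_quad hq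
  funext σ
  by_cases h : σ a = σ b
  · simp [spinTL, h]
  · have h' : spinFlip a b σ a ≠ spinFlip a b σ b := by
      rwa [spinFlip_apply_left hab, spinFlip_apply_right, ne_comm]
    rw [spinTL_apply_of_ne q a b h, spinTL_apply_of_ne q a b h, spinTL_apply_of_ne q a b h',
      spinFlip_spinFlip hab, spinFlip_apply_left hab]
    rcases Bool.eq_false_or_eq_true (σ a) with ha | ha <;>
      rcases Bool.eq_false_or_eq_true (σ b) with hb | hb
    · exact absurd (ha.trans hb.symm) h
    · simp only [ha, hb, if_true, if_false, Bool.false_eq_true]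
      rw [hinv]; linear_combination (f σ) * hq
    · simp only [ha, hb, if_true, if_false, Bool.false_eq_true]
      rw [hinv]; linear_combination (f σ) * hq
    · exact absurd (ha.trans hb.symm) h

/-- The diagonal entry of the generator: `-q` on `|↓↑⟩`, `-q⁻¹` on `|↑↓⟩`. [folklore] -/
def tlDiag (q : K) (x : Bool) : K := if x then -q else -q⁻¹

omit hq in
/-- The generator in terms of `tlDiag`. [folklore] -/
theorem spinTL_apply_of_ne' {a b : Fin L} {f : SpinConfig L → K} {σ : SpinConfig L} (h : σ a ≠ σ b) :
    spinTL q a b f σ = tlDiag q (σ a) * f σ + f (spinFlip a b σ) :=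
  spinTL_apply_of_ne q a b h

/-- Opposite spins have reciprocal diagonal entries. [folklore] -/
theorem tlDiag_mul_tlDiag {x y : Bool} (h : x ≠ y) : tlDiag q x * tlDiag q y = 1 := by
  have hq0 : q ≠ 0 := by rintro rfl; norm_num at hq
  rcases Bool.eq_false_or_eq_true x with hx | hx <;> rcases Bool.eq_false_or_eq_true y with hy | hy
  · exact absurd (hx.trans hy.symm) h
  · simp [tlDiag, hx, hy, hq0]
  · simp [tlDiag, hx, hy, hq0]
  · exact absurd (hx.trans hy.symm) h

omit hq in
/-- In `Bool`, a third value agrees with one of two distinct values. [folklore] -/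
theorem bool_eq_or_eq {x y z : Bool} (h : x ≠ y) : z = x ∨ z = y := by
  rcases Bool.eq_false_or_eq_true x with hx | hx <;> rcases Bool.eq_false_or_eq_true y with hy | hy <;>
    rcases Bool.eq_false_or_eq_true z with hz | hz <;> simp_all

/-- **`U_{ab} U_{bc} U_{ab} = U_{ab}`** for pairwise distinct sites. [cite: HagendorfLienardy2021, §3.2] -/
theorem spinTL_cubic_left (hab : a ≠ b) (hbc : b ≠ c) (hac : a ≠ c) (f : SpinConfig L → K) :
    spinTL q a b (spinTL q b c (spinTL q a b f)) = spinTL q a b f := by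
  funext σ
  by_cases h : σ a = σ b
  · rw [spinTL_apply_of_eq q a b h, spinTL_apply_of_eq q a b h]
  set g := spinTL q a b f with hg
  -- values of the flipped configuration
  have hFa : spinFlip a b σ a = σ b := spinFlip_apply_left hab σ
  have hFb : spinFlip a b σ b = σ a := spinFlip_apply_right σ
  have hFc : spinFlip a b σ c = σ c := spinFlip_apply_of_ne hac.symm hbc.symm σ
  have hgσ : g σ = tlDiag q (σ a) * f σ + f (spinFlip a b σ) := by rw [hg, spinTL_apply_of_ne' h]
  rw [spinTL_apply_of_ne' h]
  rcases bool_eq_or_eq (z := σ c) h with hc | hc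
  · -- `σ c = σ a`: the middle generator is live at `σ`, dead at the flip
    have hbc' : σ b ≠ σ c := by rw [hc]; exact Ne.symm h
    have h1 : spinTL q b c g σ = tlDiag q (σ b) * g σ := by
      rw [spinTL_apply_of_ne' hbc', add_eq_left]
      exact spinTL_apply_of_eq q a b (by
        rw [spinFlip_apply_of_ne hab hac σ, spinFlip_apply_left hbc σ, hc])
    have h2 : spinTL q b c g (spinFlip a b σ) = 0 :=
      spinTL_apply_of_eq q b c (by rw [hFb, hFc, hc])
    rw [h1, h2, add_zero, ← mul_assoc, tlDiag_mul_tlDiag hq h, one_mul]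
  · -- `σ c = σ b`: the middle generator is dead at `σ`, live at the flip
    have h1 : spinTL q b c g σ = 0 := spinTL_apply_of_eq q b c hc.symm
    have hlive : spinFlip a b σ b ≠ spinFlip a b σ c := by rw [hFb, hFc, hc]; exact h
    have h2 : spinTL q b c g (spinFlip a b σ) = tlDiag q (σ a) * g (spinFlip a b σ) := by
      rw [spinTL_apply_of_ne' hlive, hFb, add_eq_left]
      refine spinTL_apply_of_eq q a b ?_
      rw [spinFlip_apply_of_ne hab hac, spinFlip_apply_left hbc, hFa, hFc, hc]
    have h3 : g (spinFlip a b σ) = tlDiag q (σ b) * f (spinFlip a b σ) + f σ := by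
      rw [hg, spinTL_apply_of_ne' (by rw [hFa, hFb]; exact Ne.symm h), hFa, spinFlip_spinFlip hab]
    rw [h1, mul_zero, zero_add, h2, h3, mul_add, ← mul_assoc, tlDiag_mul_tlDiag hq h, one_mul, add_comm, hgσ]

/-- **`U_{bc} U_{ab} U_{bc} = U_{bc}`** for pairwise distinct sites. [cite: HagendorfLienardy2021, §3.2] -/
theorem spinTL_cubic_right (hab : a ≠ b) (hbc : b ≠ c) (hac : a ≠ c) (f : SpinConfig L → K) :
    spinTL q b c (spinTL q a b (spinTL q b c f)) = spinTL q b c f := by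
  funext σ
  by_cases h : σ b = σ c
  · rw [spinTL_apply_of_eq q b c h, spinTL_apply_of_eq q b c h]
  set g := spinTL q b c f with hg
  have hFb : spinFlip b c σ b = σ c := spinFlip_apply_left hbc σ
  have hFc : spinFlip b c σ c = σ b := spinFlip_apply_right σ
  have hFa : spinFlip b c σ a = σ a := spinFlip_apply_of_ne hab hac σ
  have hgσ : g σ = tlDiag q (σ b) * f σ + f (spinFlip b c σ) := by rw [hg, spinTL_apply_of_ne' h]
  rw [spinTL_apply_of_ne' h]
  rcases bool_eq_or_eq (z := σ a) h with ha | ha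
  · -- `σ a = σ b`: the middle generator is dead at `σ`, live at the flip
    have h1 : spinTL q a b g σ = 0 := spinTL_apply_of_eq q a b ha
    have hlive : spinFlip b c σ a ≠ spinFlip b c σ b := by rw [hFa, hFb, ha]; exact h
    have h2 : spinTL q a b g (spinFlip b c σ) = tlDiag q (σ a) * g (spinFlip b c σ) := by
      rw [spinTL_apply_of_ne' hlive, hFa, add_eq_left]
      refine spinTL_apply_of_eq q b c ?_
      rw [spinFlip_apply_right, spinFlip_apply_of_ne hac.symm hbc.symm, hFa, hFc, ha]
    have h3 : g (spinFlip b c σ) = tlDiag q (σ c) * f (spinFlip b c σ) + f σ := by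
      rw [hg, spinTL_apply_of_ne' (by rw [hFb, hFc]; exact Ne.symm h), hFb, spinFlip_spinFlip hbc]
    have hac' : σ a ≠ σ c := by rw [ha]; exact h
    rw [h1, mul_zero, zero_add, h2, h3, mul_add, ← mul_assoc, tlDiag_mul_tlDiag hq hac', one_mul, add_comm, ha, hgσ]
  · -- `σ a = σ c`: the middle generator is live at `σ`, dead at the flip
    have hab' : σ a ≠ σ b := by rw [ha]; exact Ne.symm h
    have h1 : spinTL q a b g σ = tlDiag q (σ a) * g σ := by
      rw [spinTL_apply_of_ne' hab', add_eq_left]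
      exact spinTL_apply_of_eq q b c (by
        rw [spinFlip_apply_right, spinFlip_apply_of_ne hac.symm hbc.symm, ha])
    have h2 : spinTL q a b g (spinFlip b c σ) = 0 :=
      spinTL_apply_of_eq q a b (by rw [hFa, hFb, ha])
    rw [h1, h2, add_zero, ← mul_assoc, mul_comm (tlDiag q (σ b)), tlDiag_mul_tlDiag hq hab', one_mul]

end Relations

/-! ### Far commutation -/

section Comm

variable (q : K) {a b c d : Fin L}

/-- Flips at disjoint pairs of sites commute. [folklore] -/
theorem spinFlip_comm (hac : a ≠ c) (had : a ≠ d) (hbc : b ≠ c) (hbd : b ≠ d) (σ : SpinConfig L) :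
    spinFlip a b (spinFlip c d σ) = spinFlip c d (spinFlip a b σ) := by
  funext i
  simp only [spinFlip]
  by_cases hib : i = b
  · subst hib; simp [Function.update_of_ne hbd, Function.update_of_ne hbc, Function.update_of_ne had,
      Function.update_of_ne hac]
  by_cases hia : i = a
  · subst hia; simp [Function.update_of_ne hib, Function.update_of_ne had, Function.update_of_ne hac,
      Function.update_of_ne hbd, Function.update_of_ne hbc]
  by_cases hid : i = d
  · subst hid; simp [Function.update_of_ne hib, Function.update_of_ne hia, Function.update_of_ne hac.symm,
      Function.update_of_ne hbc.symm]
  by_cases hic : i = c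
  · subst hic; simp [Function.update_of_ne hib, Function.update_of_ne hia, Function.update_of_ne hid,
      Function.update_of_ne had.symm, Function.update_of_ne hbd.symm]
  simp [Function.update_of_ne hib, Function.update_of_ne hia, Function.update_of_ne hid, Function.update_of_ne hic]

/-- **Generators at disjoint pairs of sites commute.** [cite: HagendorfLienardy2021, §3.2] -/
theorem spinTL_comm (hac : a ≠ c) (had : a ≠ d) (hbc : b ≠ c) (hbd : b ≠ d) (f : SpinConfig L → K) :
    spinTL q a b (spinTL q c d f) = spinTL q c d (spinTL q a b f) := by
  funext σ
  have hva : spinFlip c d σ a = σ a := spinFlip_apply_of_ne hac had σ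
  have hvb : spinFlip c d σ b = σ b := spinFlip_apply_of_ne hbc hbd σ
  have hvc : spinFlip a b σ c = σ c := spinFlip_apply_of_ne hac.symm hbc.symm σ
  have hvd : spinFlip a b σ d = σ d := spinFlip_apply_of_ne had.symm hbd.symm σ
  by_cases h1 : σ a = σ b
  · rw [spinTL_apply_of_eq q a b h1]
    by_cases h2 : σ c = σ d
    · rw [spinTL_apply_of_eq q c d h2]
    · rw [spinTL_apply_of_ne q c d h2, spinTL_apply_of_eq q a b h1,
        spinTL_apply_of_eq q a b (by rw [hva, hvb, h1]), mul_zero, add_zero]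
  · by_cases h2 : σ c = σ d
    · rw [spinTL_apply_of_eq q c d (by rw [h2]), spinTL_apply_of_ne q a b h1, spinTL_apply_of_eq q c d h2,
        spinTL_apply_of_eq q c d (by rw [hvc, hvd, h2]), mul_zero, add_zero]
    · rw [spinTL_apply_of_ne q a b h1, spinTL_apply_of_ne q c d h2, spinTL_apply_of_ne q c d h2,
        spinTL_apply_of_ne q c d (by rw [hvc, hvd]; exact h2), spinTL_apply_of_ne q a b h1,
        spinTL_apply_of_ne q a b (by rw [hva, hvb]; exact h1), hva, hvc, spinFlip_comm hac had hbc hbd]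
      ring

end Comm

end TemperleyLieb

end Literature.Probability.LatticeModels
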